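import Summits.ResolutionOfSingularities.ResolutionOfSingularities.Theorems.PurelyInseparableDim4SwapTransportCanonical
import Summits.ResolutionOfSingularities.ResolutionOfSingularities.Theorems.PurelyInseparableDim4JetInverse
import Mathlib.LinearAlgebra.Matrix.NonsingularInverse
import HarnessLib
import HarnessLib.Audit.Tags

/-!
# Purely inseparable four-folds — THE CANONICAL TRANSPORT: tangent invertibility, the Cramer direction, COHERENCE across
# precisions, and the reading of isolation / `ord₀` through an origin-fixing frame (cell `res-dim4-pi`, K2(p) lane, slice C;
# hN4-D «D∞ pair-confinement re-presentation», file F2 of res-dim4-typ-1 g4's design of record, bus 2026-08-29T07:44:53Z)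

[OURS · counted 0 · cell `res-dim4-pi` · K2(p) lane (holder res-dim4-p-12 g4, HOLDER WORD g4-4) · seat res-dim4-typ-1 g4.]
Nothing here proves hN4-D, TAIL-D, K2(p)/K2(5), `NoIsolatedTrap 5 5` or resolution of singularities in dimension ≥ 4 /
characteristic `p` — NOT proved.  AI kernel work, weaker than expert review.

Over F1 (`…SwapTransportCanonical`: `transθ`, `transport`, tangent rows):
* §1 **`read_of_rel`** — isolation and `ord₀` pass through ANY origin-fixing substitution with invertible tangent
  (`IsUnit det (coeff_{x_m} θ_k)`): res-dim4-p-7 g3's J1 `JetInverse.exists_approx_inverse` + SN2 `SwapNorm.isIsolated_of_rel` /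
  `ordZero_of_rel`; the slot structure of `read_of_rel₁` / `read_of_rel₂` is not needed.
* §2 **`isUnit_det_transθ`** — the tangent of the transported frame is invertible when the old one is (the direction
  correspondence `N v = λ d`, `v_ℓ = 1`, and the tangent rows of F1; proof by INJECTIVITY of `N′ *ᵥ`, no Laplace expansion).
* §3 **`exists_mulVec_eq`** / **`dir_of_mulVec`** — the Cramer direction: for invertible `N` and the real point `d = b + e_jr`
  there is `v` with `N v = d`; if `v_ℓ ≠ 0`, the virtual translation `β := v/v_ℓ − e_ℓ` and `λ := v_ℓ⁻¹` satisfy the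
  direction correspondence `hdir` of `transport`.
* §4 **`transθ_congr`** — COHERENCE: two origin-fixing frames congruent letterwise modulo `𝔪₀ᵐ` (`m ≥ n + 1`) with the same
  chart data transport to frames congruent modulo `𝔪₀ⁿ` (`n ≤ M₁, M₂`); with `coeff_single_eq_of_sub_mem` (congruence modulo
  `𝔪₀²` ⇒ equal tangents) this is what makes the D∞ virtual translation `M`-independent at the genuinely lossy steps.
[cite: Hauser2010, §§F–G] [folklore: formal inverse function theorem, truncated]
bears_on: LADDER-RESOLUTION:D157-DOOR2 (res-dim4-pi · K2(p) slice C · hN4-D F2 tangent / coherence).  Supports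
stmt-ResolutionOfSingularities-16155 (helper).
-/

set_option linter.dupNamespace false -- mandated namespace of this single-conjunct summit

noncomputable section

namespace Summit.ResolutionOfSingularities.ResolutionOfSingularities.Theorems.PIDim4

namespace SwapTransport

open MvPolynomial Finset
open Literature.AlgebraicGeometry.Resolution
open Literature.AlgebraicGeometry.Resolution.CentreBlowup
open Literature.AlgebraicGeometry.Resolution.Hauser2010

variable {K : Type} [Field K]

/-! ## §1 Isolation and `ord₀` through an origin-fixing frame with invertible tangent -/

/-- **ISOLATION AND `ord₀` PASS THROUGH ANY ORIGIN-FIXING FRAME WITH INVERTIBLE TANGENT.**  If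
`FB = clean(Uᵖ · θ(FA)) + E`, `E ∈ 𝔪₀ᴹ`, `θ(0) = 0` with `IsUnit det(coeff_{x_m} θ_k)`, `U(0) ≠ 0`, and `FA` is isolated with
certificate level `N` (`N + p + 1 ≤ M`), `ord₀ FA = o`, `p ∤ o`, `o < M`: then `FB` is isolated and `ord₀ FB = o`. [OURS]
[folklore: formal inverse function theorem, truncated] -/
theorem read_of_rel (p : ℕ) [Fact p.Prime] [CharP K p] {M N o : ℕ} {FA FB : MvPolynomial (Fin 4) K}
    {θ : Fin 4 → MvPolynomial (Fin 4) K} {U E : MvPolynomial (Fin 4) K} (hθ0 : ∀ k, constantCoeff (θ k) = 0)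
    (hdet : IsUnit (Matrix.det (Matrix.of fun k m => coeff (Finsupp.single m 1) (θ k))))
    (hU : constantCoeff U ≠ 0) (hE : E ∈ originIdeal K ^ M) (hrel : FB = deletePthPowers p (U ^ p * aeval θ FA) + E)
    (hiso : IsIsolated p FA) (hN : originIdeal K ^ N ≤ singLocusIdeal p FA ⊔ originIdeal K ^ (N + 1))
    (hM : N + p + 1 ≤ M) (ho : ordZero FA = o) (hpo : ¬ p ∣ o) (hoM : o < M) :
    IsIsolated p FB ∧ ordZero FB = o := by
  obtain ⟨θ', hθ'0, hθθ', hθ'θ⟩ := JetInverse.exists_approx_inverse θ hθ0 hdet M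
  exact ⟨SwapNorm.isIsolated_of_rel p hθ0 hθ'0 hθθ' hθ'θ hU hE hrel hiso.1 hN hM,
    SwapNorm.ordZero_of_rel p hθ0 hθ'0 hθ'θ hU hE hrel ho hpo hoM⟩

/-! ## §2 The tangent of the transported frame is invertible -/

/-- Entries of `N *ᵥ z` for the tangent matrix of a substitution. [folklore] -/
theorem tangent_mulVec_apply (θ : Fin 4 → MvPolynomial (Fin 4) K) (z : Fin 4 → K) (k : Fin 4) :
    (Matrix.of fun k m => coeff (Finsupp.single m 1) (θ k)).mulVec z k = ∑ m, coeff (Finsupp.single m 1) (θ k) * z m := by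
  rw [Matrix.mulVec, dotProduct]
  rfl

/-- The direction correspondence in matrix form: `N *ᵥ v = λ • d` for `v := (m ↦ [m = ℓ] + β_m)` (`β ℓ = 0`) and
`d := (k ↦ b_k + [k = jr])`. [folklore] -/
theorem tangent_mulVec_dir {θ : Fin 4 → MvPolynomial (Fin 4) K} {ℓ jr : Fin 4} {β b : Fin 4 → K} (hβℓ : β ℓ = 0) {lam : K}
    (hdir : ∀ k, coeff (Finsupp.single ℓ 1) (θ k) + ∑ i ∈ Finset.univ.erase ℓ, coeff (Finsupp.single i 1) (θ k) * β i =
      lam * (b k + if k = jr then 1 else 0)) (k : Fin 4) :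
    (Matrix.of fun k m => coeff (Finsupp.single m 1) (θ k)).mulVec (fun m => (if m = ℓ then 1 else 0) + β m) k =
      lam * (b k + if k = jr then 1 else 0) := by
  classical
  rw [tangent_mulVec_apply, ← hdir k]
  simp_rw [mul_add, Finset.sum_add_distrib, mul_ite, mul_one, mul_zero, Finset.sum_ite_eq' Finset.univ ℓ,
    if_pos (Finset.mem_univ ℓ)]
  rw [← Finset.add_sum_erase Finset.univ (fun i => coeff (Finsupp.single i 1) (θ k) * β i) (Finset.mem_univ ℓ), hβℓ,
    mul_zero, zero_add]

/-- **THE TANGENT OF THE TRANSPORTED FRAME IS INVERTIBLE.**  Under the hypotheses of `transport` (direction correspondence with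
`λ ≠ 0`, `M ≥ 2`) and `IsUnit det N(θ)`, also `IsUnit det N(transθ θ ℓ β jr b M)`.  Proof: if `N′ z = 0` then `z_ℓ = 0` (row
`jr`) and `N z = (N z)_jr · d` (rows `k ≠ jr`), so `N z ∈ K·N v`, `z ∈ K·v`, and `v_ℓ = 1` forces `z = 0`. [OURS] [folklore] -/
theorem isUnit_det_transθ {θ : Fin 4 → MvPolynomial (Fin 4) K} (hθ0 : ∀ k, constantCoeff (θ k) = 0) {ℓ jr : Fin 4}
    {β b : Fin 4 → K} (hβℓ : β ℓ = 0) (hbj : b jr = 0) {lam : K} (hlam : lam ≠ 0)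
    (hdir : ∀ k, coeff (Finsupp.single ℓ 1) (θ k) + ∑ i ∈ Finset.univ.erase ℓ, coeff (Finsupp.single i 1) (θ k) * β i =
      lam * (b k + if k = jr then 1 else 0)) {M : ℕ} (hM2 : 2 ≤ M)
    (hdet : IsUnit (Matrix.det (Matrix.of fun k m => coeff (Finsupp.single m 1) (θ k)))) :
    IsUnit (Matrix.det (Matrix.of fun k m => coeff (Finsupp.single m 1) (transθ θ ℓ β jr b M k))) := by
  classical
  set N : Matrix (Fin 4) (Fin 4) K := Matrix.of fun k m => coeff (Finsupp.single m 1) (θ k) with hN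
  set N' : Matrix (Fin 4) (Fin 4) K := Matrix.of fun k m => coeff (Finsupp.single m 1) (transθ θ ℓ β jr b M k) with hN'
  obtain ⟨hrows, hrow⟩ := coeff_single_transθ hθ0 hbj hlam hdir hM2
  have hNinj : Function.Injective N.mulVec :=
    Matrix.mulVec_injective_iff_isUnit.mpr ((Matrix.isUnit_iff_isUnit_det N).mpr hdet)
  rw [← Matrix.isUnit_iff_isUnit_det]
  refine Matrix.mulVec_injective_iff_isUnit.mp fun x y hxy => ?_
  -- `z := x - y` is killed by `N′`
  have hz : N'.mulVec (x - y) = 0 := by rw [Matrix.mulVec_sub, hxy, sub_self]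
  set z : Fin 4 → K := x - y with hzdef
  have hz' : ∀ k, ∑ m, coeff (Finsupp.single m 1) (transθ θ ℓ β jr b M k) * z m = 0 := fun k => by
    have h := congrFun hz k
    rwa [hN', tangent_mulVec_apply] at h
  -- row `jr`: `z ℓ = 0`
  have hzℓ : z ℓ = 0 := by
    have h := hz' jr
    simp_rw [hrow, ite_mul, zero_mul] at h
    rw [Finset.sum_ite_eq' Finset.univ ℓ, if_pos (Finset.mem_univ ℓ)] at h
    exact (mul_eq_zero.mp h).resolve_left hlam
  -- rows `k ≠ jr`: `(N z)_k = b_k · (N z)_jr`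
  have hNz : ∀ k, N.mulVec z k = b k * N.mulVec z jr + (if k = jr then 1 else 0) * N.mulVec z jr := by
    intro k
    by_cases hk : k = jr
    · rw [hk, hbj, zero_mul, zero_add, if_pos rfl, one_mul]
    · rw [if_neg hk, zero_mul, add_zero, hN, tangent_mulVec_apply, tangent_mulVec_apply, Finset.mul_sum]
      have h := hz' k
      have h' : ∑ m, lam * (coeff (Finsupp.single m 1) (transθ θ ℓ β jr b M k) * z m) = 0 := by
        rw [← Finset.mul_sum, h, mul_zero]
      have h'' : ∑ m, (coeff (Finsupp.single m 1) (θ k) - b k * coeff (Finsupp.single m 1) (θ jr)) * z m = 0 := by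
        rw [← h']
        refine Finset.sum_congr rfl fun m _ => ?_
        by_cases hm : m = ℓ
        · rw [hm, hzℓ, mul_zero, mul_zero, mul_zero]
        · rw [← mul_assoc, hrows k hk m hm]
      have h3 : ∑ m, (coeff (Finsupp.single m 1) (θ k) - b k * coeff (Finsupp.single m 1) (θ jr)) * z m =
          ∑ m, coeff (Finsupp.single m 1) (θ k) * z m - ∑ m, b k * (coeff (Finsupp.single m 1) (θ jr) * z m) := by
        rw [← Finset.sum_sub_distrib]
        exact Finset.sum_congr rfl fun m _ => by ring
      rw [h3, sub_eq_zero] at h''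
      exact h''
  -- hence `N z = c • N v`, `z = c • v`, and `z ℓ = c`
  set c : K := N.mulVec z jr with hc
  set v : Fin 4 → K := fun m => (if m = ℓ then 1 else 0) + β m with hv
  have hNv : ∀ k, N.mulVec v k = lam * (b k + if k = jr then 1 else 0) := fun k => by
    rw [hN, hv]; exact tangent_mulVec_dir hβℓ hdir k
  have hNeq : N.mulVec z = N.mulVec ((c * lam⁻¹) • v) := by
    funext k
    rw [Matrix.mulVec_smul, Pi.smul_apply, smul_eq_mul, hNv k, hNz k, mul_assoc, inv_mul_cancel_left₀ hlam]
    ring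
  have hzv : z = (c * lam⁻¹) • v := hNinj hNeq
  have hvℓ : v ℓ = 1 := by rw [hv]; dsimp only; rw [if_pos rfl, hβℓ, add_zero]
  have hc0 : c = 0 := by
    have h := congrFun hzv ℓ
    rw [hzℓ, Pi.smul_apply, smul_eq_mul, hvℓ, mul_one] at h
    exact (mul_eq_zero.mp h.symm).resolve_right (inv_ne_zero hlam)
  have hz0 : z = 0 := by rw [hzv, hc0, zero_mul, zero_smul]
  exact sub_eq_zero.mp hz0

/-! ## §3 The Cramer direction -/

/-- **Every real point has a virtual preimage direction** when the tangent is invertible. [folklore] -/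
theorem exists_mulVec_eq {N : Matrix (Fin 4) (Fin 4) K} (hdet : IsUnit N.det) (d : Fin 4 → K) :
    ∃ v : Fin 4 → K, N.mulVec v = d :=
  Matrix.mulVec_surjective_iff_isUnit.mpr ((Matrix.isUnit_iff_isUnit_det N).mpr hdet) d

/-- **FROM A PREIMAGE DIRECTION TO THE DIRECTION CORRESPONDENCE.**  If `N(θ) v = d` with `d_k = b_k + [k = jr]` and
`v_ℓ ≠ 0`, then `β := (m ↦ [m ≠ ℓ]·v_m/v_ℓ)` and `λ := v_ℓ⁻¹` satisfy `hdir` of `transport` (and `β ℓ = 0`, `λ ≠ 0`). [folklore] -/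
theorem dir_of_mulVec {θ : Fin 4 → MvPolynomial (Fin 4) K} {ℓ jr : Fin 4} {b v : Fin 4 → K}
    (hNv : ∀ k, (Matrix.of fun k m => coeff (Finsupp.single m 1) (θ k)).mulVec v k = b k + if k = jr then 1 else 0)
    (hvℓ : v ℓ ≠ 0) :
    (fun m => if m = ℓ then (0 : K) else v m / v ℓ) ℓ = 0 ∧ (v ℓ)⁻¹ ≠ 0 ∧
      ∀ k, coeff (Finsupp.single ℓ 1) (θ k) +
        ∑ i ∈ Finset.univ.erase ℓ, coeff (Finsupp.single i 1) (θ k) * (fun m => if m = ℓ then (0 : K) else v m / v ℓ) i =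
          (v ℓ)⁻¹ * (b k + if k = jr then 1 else 0) := by
  classical
  refine ⟨by simp, inv_ne_zero hvℓ, fun k => ?_⟩
  rw [← hNv k, tangent_mulVec_apply, Finset.mul_sum, ← Finset.add_sum_erase Finset.univ _ (Finset.mem_univ ℓ),
    show (v ℓ)⁻¹ * (coeff (Finsupp.single ℓ 1) (θ k) * v ℓ) = coeff (Finsupp.single ℓ 1) (θ k) by
      rw [mul_comm, mul_assoc, mul_inv_cancel₀ hvℓ, mul_one]]
  refine congrArg _ (Finset.sum_congr rfl fun m hm => ?_)
  simp only [if_neg (Finset.ne_of_mem_erase hm)]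
  rw [div_eq_mul_inv]
  ring

/-! ## §4 Coherence across precisions -/

/-- Substitutions congruent modulo `𝔪₀²` have the same tangent. [folklore] -/
theorem coeff_single_eq_of_sub_mem {P Q : MvPolynomial (Fin 4) K} {m : ℕ} (h : P - Q ∈ originIdeal K ^ m) (hm : 2 ≤ m)
    (i : Fin 4) : coeff (Finsupp.single i 1) P = coeff (Finsupp.single i 1) Q := by
  have h0 : coeff (Finsupp.single i 1) (P - Q) = 0 :=
    (IsolationCert.mem_originIdeal_pow_iff m _).mp h _ (by rw [Finsupp.degree_single]; omega)
  rwa [coeff_sub, sub_eq_zero] at h0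

/-- Substitutions congruent modulo `𝔪₀ᵐ`, `m ≥ 1`, have the same constant terms. [folklore] -/
theorem constantCoeff_eq_of_sub_mem {P Q : MvPolynomial (Fin 4) K} {m : ℕ} (h : P - Q ∈ originIdeal K ^ m) (hm : 1 ≤ m) :
    constantCoeff P = constantCoeff Q := by
  have h0 : coeff 0 (P - Q) = 0 := (IsolationCert.mem_originIdeal_pow_iff m _).mp h _ (by rw [map_zero]; omega)
  rwa [coeff_sub, sub_eq_zero, ← constantCoeff_eq] at h0

/-- **The direction correspondence only sees the tangent**: it transfers along a congruence modulo `𝔪₀ᵐ`, `m ≥ 2`. [folklore] -/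
theorem dir_congr {θ₁ θ₂ : Fin 4 → MvPolynomial (Fin 4) K} {m : ℕ} (hm : 2 ≤ m) (h : ∀ k, θ₁ k - θ₂ k ∈ originIdeal K ^ m)
    {ℓ jr : Fin 4} {β b : Fin 4 → K} {lam : K}
    (hdir : ∀ k, coeff (Finsupp.single ℓ 1) (θ₁ k) + ∑ i ∈ Finset.univ.erase ℓ, coeff (Finsupp.single i 1) (θ₁ k) * β i =
      lam * (b k + if k = jr then 1 else 0)) (k : Fin 4) :
    coeff (Finsupp.single ℓ 1) (θ₂ k) + ∑ i ∈ Finset.univ.erase ℓ, coeff (Finsupp.single i 1) (θ₂ k) * β i =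
      lam * (b k + if k = jr then 1 else 0) := by
  rw [← hdir k, coeff_single_eq_of_sub_mem (h k) hm]
  refine congrArg _ (Finset.sum_congr rfl fun i _ => ?_)
  rw [coeff_single_eq_of_sub_mem (h k) hm]

/-- The blow-up substitution maps `𝔪₀ᵐ` into `x_ℓᵐ · R`. [folklore] -/
theorem exists_eq_X_pow_mul_of_mem {ℓ : Fin 4} (β : Fin 4 → K) {m : ℕ} {G : MvPolynomial (Fin 4) K}
    (hG : G ∈ originIdeal K ^ m) : ∃ H : MvPolynomial (Fin 4) K, aeval (blowupSub ℓ β) G = X ℓ ^ m * H := by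
  have h := aeval_blowup_mem_span_pow ℓ β hG
  rw [← blowupSub_def] at h
  obtain ⟨H, hH⟩ := Ideal.mem_span_singleton'.mp h
  exact ⟨H, by rw [← hH, mul_comm]⟩

/-- **Blow-up factors of congruent origin-free polynomials are congruent one level down**:
`G₁ − G₂ ∈ 𝔪₀ᵐ` ⇒ `G̃₁ − G̃₂ ∈ 𝔪₀^{m−1}`. [folklore] -/
theorem blowupFactor_sub_mem {ℓ : Fin 4} (β : Fin 4 → K) {m : ℕ} (hm : 1 ≤ m) {G₁ G₂ : MvPolynomial (Fin 4) K}
    (h₁ : constantCoeff G₁ = 0) (h₂ : constantCoeff G₂ = 0) (h : G₁ - G₂ ∈ originIdeal K ^ m) :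
    blowupFactor ℓ β G₁ - blowupFactor ℓ β G₂ ∈ originIdeal K ^ (m - 1) := by
  obtain ⟨H, hH⟩ := exists_eq_X_pow_mul_of_mem β (ℓ := ℓ) h
  have hX : X ℓ * (blowupFactor ℓ β G₁ - blowupFactor ℓ β G₂) = X ℓ * (X ℓ ^ (m - 1) * H) := by
    rw [mul_sub, (blowupFactor_spec ℓ β h₁).1, (blowupFactor_spec ℓ β h₂).1, ← map_sub, hH, ← mul_assoc, ← pow_succ',
      Nat.sub_add_cancel hm]
  rw [mul_left_cancel₀ (X_ne_zero ℓ) hX]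
  refine Ideal.mul_mem_right _ _ (Ideal.pow_mem_pow ?_ _)
  exact (NarrowApolarity.mem_originIdeal_iff _).mpr (constantCoeff_X (R := K) ℓ)

/-- **Inverses modulo powers of `𝔪₀` of congruent units are congruent**: `V₁ − V₂ ∈ 𝔪₀ⁿ`, `n ≤ M₁, M₂` ⇒
`invModPow V₁ M₁ − invModPow V₂ M₂ ∈ 𝔪₀ⁿ`. [folklore] -/
theorem invModPow_sub_mem {V₁ V₂ : MvPolynomial (Fin 4) K} (hV₁ : constantCoeff V₁ ≠ 0) (hV₂ : constantCoeff V₂ ≠ 0)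
    {n M₁ M₂ : ℕ} (h : V₁ - V₂ ∈ originIdeal K ^ n) (h1 : n ≤ M₁) (h2 : n ≤ M₂) (hM₁ : 2 ≤ M₁) (hM₂ : 2 ≤ M₂) :
    invModPow V₁ M₁ - invModPow V₂ M₂ ∈ originIdeal K ^ n := by
  obtain ⟨-, hW₁, -⟩ := invModPow_spec hV₁ hM₁
  obtain ⟨-, hW₂, -⟩ := invModPow_spec hV₂ hM₂
  set W₁ := invModPow V₁ M₁
  set W₂ := invModPow V₂ M₂
  have hid : W₁ - W₂ = W₁ * W₂ * (V₂ - V₁) - W₁ * (W₂ * V₂ - 1) + W₂ * (W₁ * V₁ - 1) := by ring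
  rw [hid]
  refine Submodule.add_mem _ (Submodule.sub_mem _ (Ideal.mul_mem_left _ _ ?_)
    (Ideal.mul_mem_left _ _ (Ideal.pow_le_pow_right h2 hW₂))) (Ideal.mul_mem_left _ _ (Ideal.pow_le_pow_right h1 hW₁))
  rw [← neg_sub]
  exact Submodule.neg_mem _ h

/-- **COHERENCE OF THE CANONICAL TRANSPORT.**  Two origin-fixing frames congruent letterwise modulo `𝔪₀ᵐ` (`n + 1 ≤ m`), with
the same chart data and the direction correspondence for the first (hence for both), transport at precisions `M₁, M₂ ≥ n`
(`≥ 2`) to frames congruent letterwise modulo `𝔪₀ⁿ`. [OURS] [folklore] -/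
theorem transθ_congr {θ₁ θ₂ : Fin 4 → MvPolynomial (Fin 4) K} (hθ₁ : ∀ k, constantCoeff (θ₁ k) = 0)
    (hθ₂ : ∀ k, constantCoeff (θ₂ k) = 0) {m n : ℕ} (hn : 1 ≤ n) (hmn : n + 1 ≤ m)
    (h : ∀ k, θ₁ k - θ₂ k ∈ originIdeal K ^ m) {ℓ jr : Fin 4} {β b : Fin 4 → K} (hbj : b jr = 0) {lam : K} (hlam : lam ≠ 0)
    (hdir : ∀ k, coeff (Finsupp.single ℓ 1) (θ₁ k) + ∑ i ∈ Finset.univ.erase ℓ, coeff (Finsupp.single i 1) (θ₁ k) * β i =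
      lam * (b k + if k = jr then 1 else 0)) {M₁ M₂ : ℕ} (hM₁ : 2 ≤ M₁) (hM₂ : 2 ≤ M₂) (h1 : n ≤ M₁) (h2 : n ≤ M₂) (k : Fin 4) :
    transθ θ₁ ℓ β jr b M₁ k - transθ θ₂ ℓ β jr b M₂ k ∈ originIdeal K ^ n := by
  have hm2 : 2 ≤ m := by omega
  have hdir₂ := dir_congr hm2 h hdir
  -- the blow-up factors are congruent modulo `𝔪₀^{m-1} ⊆ 𝔪₀ⁿ`
  have hGt : ∀ k', blowupFactor ℓ β (θ₁ k') - blowupFactor ℓ β (θ₂ k') ∈ originIdeal K ^ n := fun k' =>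
    Ideal.pow_le_pow_right (by omega) (blowupFactor_sub_mem β (by omega) (hθ₁ k') (hθ₂ k') (h k'))
  have hV₁ : constantCoeff (blowupFactor ℓ β (θ₁ jr)) = lam := by
    rw [constantCoeff_blowupFactor_of_dir hθ₁ hdir jr, if_pos rfl, hbj, zero_add, mul_one]
  have hV₂ : constantCoeff (blowupFactor ℓ β (θ₂ jr)) = lam := by
    rw [constantCoeff_blowupFactor_of_dir hθ₂ hdir₂ jr, if_pos rfl, hbj, zero_add, mul_one]
  have hW : invModPow (blowupFactor ℓ β (θ₁ jr)) M₁ - invModPow (blowupFactor ℓ β (θ₂ jr)) M₂ ∈ originIdeal K ^ n :=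
    invModPow_sub_mem (by rw [hV₁]; exact hlam) (by rw [hV₂]; exact hlam) (hGt jr) h1 h2 hM₁ hM₂
  by_cases hk : k = jr
  · rw [hk, transθ_self, transθ_self, ← mul_sub]
    exact Ideal.mul_mem_left _ _ (hGt jr)
  · rw [transθ_of_ne θ₁ ℓ β b M₁ hk, transθ_of_ne θ₂ ℓ β b M₂ hk,
      show invModPow (blowupFactor ℓ β (θ₁ jr)) M₁ * blowupFactor ℓ β (θ₁ k) - C (b k) -
          (invModPow (blowupFactor ℓ β (θ₂ jr)) M₂ * blowupFactor ℓ β (θ₂ k) - C (b k)) =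
        invModPow (blowupFactor ℓ β (θ₁ jr)) M₁ * (blowupFactor ℓ β (θ₁ k) - blowupFactor ℓ β (θ₂ k)) +
          (invModPow (blowupFactor ℓ β (θ₁ jr)) M₁ - invModPow (blowupFactor ℓ β (θ₂ jr)) M₂) * blowupFactor ℓ β (θ₂ k)
        by ring]
    exact Submodule.add_mem _ (Ideal.mul_mem_left _ _ (hGt k)) (Ideal.mul_mem_right _ _ hW)

/-- **Transported frames from congruent inputs have the same tangent and the same newborn unit.**  Corollary of
`transθ_congr` with `n = 2`. [OURS] -/
theorem coeff_single_transθ_congr {θ₁ θ₂ : Fin 4 → MvPolynomial (Fin 4) K} (hθ₁ : ∀ k, constantCoeff (θ₁ k) = 0)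
    (hθ₂ : ∀ k, constantCoeff (θ₂ k) = 0) {m : ℕ} (hm : 3 ≤ m) (h : ∀ k, θ₁ k - θ₂ k ∈ originIdeal K ^ m)
    {ℓ jr : Fin 4} {β b : Fin 4 → K} (hbj : b jr = 0) {lam : K} (hlam : lam ≠ 0)
    (hdir : ∀ k, coeff (Finsupp.single ℓ 1) (θ₁ k) + ∑ i ∈ Finset.univ.erase ℓ, coeff (Finsupp.single i 1) (θ₁ k) * β i =
      lam * (b k + if k = jr then 1 else 0)) {M₁ M₂ : ℕ} (hM₁ : 2 ≤ M₁) (hM₂ : 2 ≤ M₂) (k i : Fin 4) :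
    coeff (Finsupp.single i 1) (transθ θ₁ ℓ β jr b M₁ k) = coeff (Finsupp.single i 1) (transθ θ₂ ℓ β jr b M₂ k) :=
  coeff_single_eq_of_sub_mem (transθ_congr hθ₁ hθ₂ (n := 2) (by norm_num) (by omega) h hbj hlam hdir hM₁ hM₂ hM₁ hM₂ k)
    le_rfl i

end SwapTransport

end Summit.ResolutionOfSingularities.ResolutionOfSingularities.Theorems.PIDim4

end
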